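import Literature.Probability.LatticeModels.InterfaceSLE
import Literature.Probability.LatticeModels.DobrushinDiscretisation
import HarnessLib

/-!
# `IsDiscretisation` and `ZdDiscretisationFamily` are the same hypothesis (bridge lemmas)

`Literature.Probability.LatticeModels.ZdDiscretisationFamily D E`
(`DobrushinDiscretisation.lean`, light import cone: `MedialInterface` + `PlanarDomains`) is the
verbatim, model-independent copy of the hypothesis structure
`Literature.Probability.LatticeModels.IsDiscretisation D E` of `InterfaceSLE.lean` (which sits
behind the Ising imports `PlanarIsing`, `FermionicObservable`, `RandomCluster`, …): the same six
fields `Ω_eq`, `δ_eq`, `tendsto_arcA`, `tendsto_arcB`, `tendsto_zdABEdges`,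
`eventually_isZdAdmissible`, with the same types — CDHKS's discrete Dobrushin approximations
`(Ω_δ; a_δ, b_δ) → (Ω; a, b)` (Chelkak–Duminil-Copin–Hongler–Kemppainen–Smirnov 2014, §1) on
the canonical vertex set `meshDomain`. This file, which imports both, records the (trivial)
equivalence once, so that statements phrased with either spelling — the Ising-side facts
`convergesInLawToSLE_three_isingInterface`, `convergesInLawToSLE_sixteen_thirds_fkInterface`
(`IsDiscretisation`) and the percolation-side `SLE6LimitZ2AllDiscretisations`
(`ZdDiscretisationFamily`, after the re-base of `InterfaceScalingLimitDiscretised.lean` on the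
light file, definition item `defn-ZdDiscretisationFamily`) — can be combined by one rewrite.
Nothing is defined here.

* `IsDiscretisation.toZdDiscretisationFamily`, `ZdDiscretisationFamily.toIsDiscretisation` —
  the two directions (dot notation);
* `isDiscretisation_iff_zdDiscretisationFamily` — the `Iff`, for `rw`/`simp`.

## References

* D. Chelkak, H. Duminil-Copin, C. Hongler, A. Kemppainen, S. Smirnov, *Convergence of Ising
  interfaces to Schramm's SLE curves*, C. R. Math. Acad. Sci. Paris 352 (2014) 157–161, §1
  [CDHKSCRAS2014].
-/

namespace Literature.Probability.LatticeModels

variable {D : RandomPlanarGeometry.DobrushinDomain} {E : ℝ → DiscreteDobrushin}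

/-- An `IsDiscretisation` family is a `ZdDiscretisationFamily` (same fields).
(CDHKS 2014, §1, for the notion.) [folklore] -/
theorem IsDiscretisation.toZdDiscretisationFamily (h : IsDiscretisation D E) :
    ZdDiscretisationFamily D E :=
  ⟨h.Ω_eq, h.δ_eq, h.tendsto_arcA, h.tendsto_arcB, h.tendsto_zdABEdges,
    h.eventually_isZdAdmissible⟩

/-- A `ZdDiscretisationFamily` is an `IsDiscretisation` family (same fields).
(CDHKS 2014, §1, for the notion.) [folklore] -/
theorem ZdDiscretisationFamily.toIsDiscretisation (h : ZdDiscretisationFamily D E) :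
    IsDiscretisation D E :=
  ⟨h.Ω_eq, h.δ_eq, h.tendsto_arcA, h.tendsto_arcB, h.tendsto_zdABEdges,
    h.eventually_isZdAdmissible⟩

variable (D E) in
/-- `IsDiscretisation D E ↔ ZdDiscretisationFamily D E`: the two spellings of "the discrete
Dobrushin data `E δ` discretise `(D; a, b)`" agree. (CDHKS 2014, §1, for the notion.)
[folklore] -/
theorem isDiscretisation_iff_zdDiscretisationFamily :
    IsDiscretisation D E ↔ ZdDiscretisationFamily D E :=
  ⟨IsDiscretisation.toZdDiscretisationFamily, ZdDiscretisationFamily.toIsDiscretisation⟩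

end Literature.Probability.LatticeModels
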